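import Summits.CriticalPhenomena.PercolationContinuityZ3.Theorems.PercNearOneGluingNoHeavyQuantLongTailTripleHubAlg
import HarnessLib

/-!
# QUANT lane R8, T-DEC: LONG-TAIL TRIPLE HUB — the second route's closed forms on the WIDER shape range `3lo ≤ K ≤ 4lo` (census-1 gen 32)

builds on p205010 (kernel theorem, internal audit signed; external expert review pending)

Support file (`--supports stmt-CriticalPhenomena-4575`), QUANT lane seat prim-quant-census-1 (gen 32); memo
`run/shared/lean/prim/quant/prim-quant-census-1/g32/TWOLO-G32.md` §6 (iii)/(i).  Theorems only, standard axioms, no sorries.  Pure real-polynomial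
inequalities — the two certificates of the `3lo+2K` route of the width-3 hub (`…QuantLongTailTripleHubAlg`: `ltTriple_capTop`, `ltTriple_cost0`, there for
`2lo ≤ K ≤ 3lo`) re-certified for `3lo ≤ K ≤ 4lo`, the first bricks of the successor's width-3 theorem beyond `3lo` (memo §6: three single-low branches plus
'everything to the top'; the `3lo+K` branch's floor capacity `ltTriple_capMid` has no shape restriction).  Notation as there: gates `g₁ ≤ g₂, g₃` in
`[lo/K, 1]`, `u₀ = (1−g₁)(1−g₂)(1−g₃)`, `u₁ = Σ gᵢ(1−gⱼ)(1−gₖ)`, `u₂ = Σ gᵢgⱼ(1−gₖ)`.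
* `ltTriple_capTop_wide` — `K·u₁ ≤ (K(g₁+g₂+g₃) − 3lo)(u₀+u₁)` ⟹ `(lo+Kg₁)(u₀+u₂) ≤ (lo+K)u₂` (degree-4 Handelman certificate, 21 products: kit j296087).
* `ltTriple_cost0_wide` — `x·u₀[(2K−3lo)u₀ + (K−3lo)u₁] ≤ 3lo(1−x)(u₀+u₁)²` for `x(lo+K) ≤ lo+Kg₁` (degree-8 certificate of
  `3loK(1−g₁)(u₀+u₁)² ≥ (lo+Kg₁)u₀[(2K−3lo)u₀+(K−3lo)u₁]`, 25 products: kit j296087; for `K ≤ 3lo` the one-gate parabola of `ltTriple_cost0` did it).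
NUMERICS (memo §6 (ii), code/exp36): both closed forms hold with 0 failures on 2 925 gate triples per `c = lo/K ∈ {1/4, 4/15, 2/7, 3/10, 8/25, 1/3}`.

HONEST STATUS.  Algebra only; `SiblingStep`, `GluedDominatedMass`, `SDECConvClosed`, `FarTreeRow` OPEN; RATE class (log\*) / honest sentence of
`run/shared/lean/prim/quant/README.md` unchanged.  [this work].  Nothing here is cited as a published result.  The gluing rows served
[cite: KozmaNitzan2024, Conjecture 3 (p. 15)]; product measure [cite: Grimmett1999, §1.3 p. 10].
-/

noncomputable section

namespace Summit.CriticalPhenomena.PercolationContinuityZ3.Theorems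
namespace Quant
namespace LawDec

/-- **the second atom's floor capacity when the middle-low credit is exhausted, `3lo ≤ K ≤ 4lo`** (`g₁` the least gate): if
`K·u₁ ≤ (K(g₁+g₂+g₃) − 3lo)(u₀+u₁)` then `(lo+Kg₁)(u₀+u₂) ≤ (lo+K)·u₂`.  Certificate: 21 products of `Kgᵢ−lo, 1−gᵢ, g₂−g₁, g₃−g₁, 4lo−K, K−3lo, K` and the
premise (float LP + exact repair). [this work] -/
theorem ltTriple_capTop_wide (lo K g₁ g₂ g₃ : ℝ) (hlo : 0 < lo) (hK3 : 3 * lo ≤ K) (hK4 : K ≤ 4 * lo) (hg₁ : lo ≤ K * g₁) (h12 : g₁ ≤ g₂)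
    (h13 : g₁ ≤ g₃) (h21 : g₂ ≤ 1) (h31 : g₃ ≤ 1)
    (htop : K * (g₁ * (1 - g₂) * (1 - g₃) + g₂ * (1 - g₁) * (1 - g₃) + g₃ * (1 - g₁) * (1 - g₂))
      ≤ (K * (g₁ + g₂ + g₃) - 3 * lo) * ((1 - g₁) * (1 - g₂) * (1 - g₃) + (g₁ * (1 - g₂) * (1 - g₃) + g₂ * (1 - g₁) * (1 - g₃) + g₃ * (1 - g₁) * (1 - g₂)))) :
    (lo + K * g₁) * ((1 - g₁) * (1 - g₂) * (1 - g₃) + (g₁ * g₂ * (1 - g₃) + g₁ * g₃ * (1 - g₂) + g₂ * g₃ * (1 - g₁)))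
      ≤ (lo + K) * (g₁ * g₂ * (1 - g₃) + g₁ * g₃ * (1 - g₂) + g₂ * g₃ * (1 - g₁)) := by
  have hK : 0 < K := by linarith
  have hA1 : 0 ≤ K * g₁ - lo := sub_nonneg.2 hg₁
  have hA2 : 0 ≤ K * g₂ - lo := by have := mul_le_mul_of_nonneg_left h12 hK.le; linarith
  have hA3 : 0 ≤ K * g₃ - lo := by have := mul_le_mul_of_nonneg_left h13 hK.le; linarith
  have hE1 : 0 ≤ 1 - g₁ := by linarith
  have hE2 : 0 ≤ 1 - g₂ := sub_nonneg.2 h21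
  have hE3 : 0 ≤ 1 - g₃ := sub_nonneg.2 h31
  have h21' : 0 ≤ g₂ - g₁ := sub_nonneg.2 h12
  have h31' : 0 ≤ g₃ - g₁ := sub_nonneg.2 h13
  have hClo : 0 ≤ 4 * lo - K := by linarith
  have hChi : 0 ≤ K - 3 * lo := by linarith
  have hP : 0 ≤ (K * (g₁ + g₂ + g₃) - 3 * lo) * ((1 - g₁) * (1 - g₂) * (1 - g₃) + (g₁ * (1 - g₂) * (1 - g₃) + g₂ * (1 - g₁) * (1 - g₃) + g₃ * (1 - g₁) * (1 - g₂)))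
      - K * (g₁ * (1 - g₂) * (1 - g₃) + g₂ * (1 - g₁) * (1 - g₃) + g₃ * (1 - g₁) * (1 - g₂)) := sub_nonneg.2 htop
  have key : 0 ≤ K * ((lo + K) * (g₁ * g₂ * (1 - g₃) + g₁ * g₃ * (1 - g₂) + g₂ * g₃ * (1 - g₁))
      - (lo + K * g₁) * ((1 - g₁) * (1 - g₂) * (1 - g₃) + (g₁ * g₂ * (1 - g₃) + g₁ * g₃ * (1 - g₂) + g₂ * g₃ * (1 - g₁)))) := by
    linarith [mul_nonneg hP hK.le,
      mul_nonneg (mul_nonneg (mul_nonneg (mul_nonneg hE2 h31') h31') hK.le) hK.le,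
      mul_nonneg (mul_nonneg (mul_nonneg hE2 hE3) hClo) hK.le,
      mul_nonneg (mul_nonneg (mul_nonneg hE1 hE3) hClo) hK.le,
      mul_nonneg (mul_nonneg (mul_nonneg hE1 hE2) hClo) hK.le,
      mul_nonneg (mul_nonneg (mul_nonneg (mul_nonneg hE1 hE2) hE3) hChi) hK.le,
      mul_nonneg (mul_nonneg (mul_nonneg (mul_nonneg (mul_nonneg hE1 hE2) hE3) h31') hK.le) hK.le,
      mul_nonneg (mul_nonneg (mul_nonneg (mul_nonneg (mul_nonneg hE1 hE2) hE3) h21') hK.le) hK.le,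
      mul_nonneg (mul_nonneg (mul_nonneg hE1 hE1) hClo) hK.le,
      mul_nonneg (mul_nonneg (mul_nonneg (mul_nonneg hE1 hE1) hE3) hChi) hK.le,
      mul_nonneg (mul_nonneg (mul_nonneg (mul_nonneg hE1 hE1) hE2) hChi) hK.le,
      mul_nonneg (mul_nonneg (mul_nonneg hA3 hE2) h31') hK.le,
      mul_nonneg (mul_nonneg (mul_nonneg hA3 hE1) h31') hK.le,
      mul_nonneg (mul_nonneg (mul_nonneg hA3 hE1) h31') hClo,
      mul_nonneg (mul_nonneg (mul_nonneg hA2 hE3) h21') hK.le,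
      mul_nonneg (mul_nonneg (mul_nonneg hA2 hE3) h21') hClo,
      mul_nonneg (mul_nonneg (mul_nonneg hA2 hE1) h21') hK.le,
      mul_nonneg (mul_nonneg (mul_nonneg hA2 hA3) hE1) h31',
      mul_nonneg (mul_nonneg (mul_nonneg hA1 hE1) hE3) hK.le,
      mul_nonneg (mul_nonneg (mul_nonneg hA1 hE1) hE2) hK.le,
      mul_nonneg (mul_nonneg (mul_nonneg hA1 hA2) hE3) h21']
  nlinarith [key]

/-- **the torque cost at the switching point, `3lo ≤ K ≤ 4lo`** (`0 < lo`, `lo ≤ Kg₁`, `g₁ ≤ g₂, g₃ ≤ 1`, any `x` with `x(lo+K) ≤ lo+Kg₁`):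
`x·u₀·[(2K−3lo)u₀ + (K−3lo)u₁] ≤ 3lo(1−x)(u₀+u₁)²`.  At the largest floor this is `3loK(1−g₁)(u₀+u₁)² ≥ (lo+Kg₁)u₀[(2K−3lo)u₀+(K−3lo)u₁]`, a degree-8
Handelman certificate with 25 products of `Kg₁−lo, 1−gᵢ, g₂−g₁, g₃−g₁, 4lo−K, K−3lo, K` (float LP + exact repair). [this work] -/
theorem ltTriple_cost0_wide (lo K g₁ g₂ g₃ x : ℝ) (hlo : 0 < lo) (hK3 : 3 * lo ≤ K) (hK4 : K ≤ 4 * lo) (hg : lo ≤ K * g₁) (h12 : g₁ ≤ g₂)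
    (h13 : g₁ ≤ g₃) (h21 : g₂ ≤ 1) (h31 : g₃ ≤ 1) (hxg : x * (lo + K) ≤ lo + K * g₁) :
    x * ((1 - g₁) * (1 - g₂) * (1 - g₃)) * ((2 * K - 3 * lo) * ((1 - g₁) * (1 - g₂) * (1 - g₃))
        + (K - 3 * lo) * (g₁ * (1 - g₂) * (1 - g₃) + g₂ * (1 - g₁) * (1 - g₃) + g₃ * (1 - g₁) * (1 - g₂)))
      ≤ 3 * lo * (1 - x) * ((1 - g₁) * (1 - g₂) * (1 - g₃) + (g₁ * (1 - g₂) * (1 - g₃) + g₂ * (1 - g₁) * (1 - g₃) + g₃ * (1 - g₁) * (1 - g₂))) ^ 2 := by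
  have hK : 0 < K := by linarith
  have hB0 : 0 < lo + K := by linarith
  have hA1 : 0 ≤ K * g₁ - lo := sub_nonneg.2 hg
  have hE1 : 0 ≤ 1 - g₁ := by linarith
  have hE2 : 0 ≤ 1 - g₂ := sub_nonneg.2 h21
  have hE3 : 0 ≤ 1 - g₃ := sub_nonneg.2 h31
  have h21' : 0 ≤ g₂ - g₁ := sub_nonneg.2 h12
  have h31' : 0 ≤ g₃ - g₁ := sub_nonneg.2 h13
  have hClo : 0 ≤ 4 * lo - K := by linarith
  have hChi : 0 ≤ K - 3 * lo := by linarith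
  set u0 : ℝ := (1 - g₁) * (1 - g₂) * (1 - g₃) with hu0
  set u1 : ℝ := g₁ * (1 - g₂) * (1 - g₃) + g₂ * (1 - g₁) * (1 - g₃) + g₃ * (1 - g₁) * (1 - g₂) with hu1
  have hu0n : 0 ≤ u0 := mul_nonneg (mul_nonneg hE1 hE2) hE3
  have hbr : 0 ≤ (2 * K - 3 * lo) * u0 + (K - 3 * lo) * u1 := by
    have hg1 : 0 ≤ g₁ := by nlinarith
    have hu1n : 0 ≤ u1 := by
      rw [hu1]
      have : 0 ≤ g₂ := by linarith
      have : 0 ≤ g₃ := by linarith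
      positivity
    have := mul_nonneg (by linarith : 0 ≤ 2 * K - 3 * lo) hu0n
    have := mul_nonneg hChi hu1n
    linarith
  -- the certificate at the largest floor
  have key : (lo + K * g₁) * (u0 * ((2 * K - 3 * lo) * u0 + (K - 3 * lo) * u1)) ≤ 3 * lo * K * (1 - g₁) * (u0 + u1) ^ 2 := by
    rw [hu0, hu1]
    linarith [mul_nonneg (mul_nonneg (mul_nonneg (mul_nonneg (mul_nonneg (mul_nonneg hE1 hE2) hE2) hE3) h31') hK.le) hK.le,
      mul_nonneg (mul_nonneg (mul_nonneg (mul_nonneg (mul_nonneg (mul_nonneg hE1 hE2) hE2) hE3) hE3) hClo) hClo,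
      mul_nonneg (mul_nonneg (mul_nonneg (mul_nonneg (mul_nonneg (mul_nonneg hE1 hE1) hE3) hE3) h21') hK.le) hK.le,
      mul_nonneg (mul_nonneg (mul_nonneg (mul_nonneg (mul_nonneg (mul_nonneg hE1 hE1) hE2) hE3) h31') hK.le) hK.le,
      mul_nonneg (mul_nonneg (mul_nonneg (mul_nonneg (mul_nonneg (mul_nonneg hE1 hE1) hE2) hE3) h21') hK.le) hK.le,
      mul_nonneg (mul_nonneg (mul_nonneg (mul_nonneg (mul_nonneg (mul_nonneg (mul_nonneg hE1 hE1) hE2) hE3) h21') h31') hK.le) hK.le,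
      mul_nonneg (mul_nonneg (mul_nonneg (mul_nonneg (mul_nonneg (mul_nonneg hE1 hE1) hE2) hE3) hE3) hClo) hK.le,
      mul_nonneg (mul_nonneg (mul_nonneg (mul_nonneg (mul_nonneg (mul_nonneg hE1 hE1) hE2) hE3) hE3) hClo) hClo,
      mul_nonneg (mul_nonneg (mul_nonneg (mul_nonneg (mul_nonneg (mul_nonneg hE1 hE1) hE2) hE2) h31') hK.le) hK.le,
      mul_nonneg (mul_nonneg (mul_nonneg (mul_nonneg (mul_nonneg (mul_nonneg hE1 hE1) hE2) hE2) hE3) hClo) hK.le,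
      mul_nonneg (mul_nonneg (mul_nonneg (mul_nonneg (mul_nonneg (mul_nonneg hE1 hE1) hE2) hE2) hE3) hClo) hClo,
      mul_nonneg (mul_nonneg (mul_nonneg (mul_nonneg (mul_nonneg (mul_nonneg (mul_nonneg hE1 hE1) hE2) hE2) hE3) hE3) hChi) hK.le,
      mul_nonneg (mul_nonneg (mul_nonneg (mul_nonneg (mul_nonneg (mul_nonneg (mul_nonneg hE1 hE1) hE2) hE2) hE3) hE3) hClo) hChi,
      mul_nonneg (mul_nonneg (mul_nonneg (mul_nonneg (mul_nonneg (mul_nonneg hE1 hE1) hE1) hE3) hE3) hClo) hK.le,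
      mul_nonneg (mul_nonneg (mul_nonneg (mul_nonneg (mul_nonneg (mul_nonneg hE1 hE1) hE1) hE2) hE3) hClo) hK.le,
      mul_nonneg (mul_nonneg (mul_nonneg (mul_nonneg (mul_nonneg (mul_nonneg hE1 hE1) hE1) hE2) hE2) hClo) hK.le,
      mul_nonneg (mul_nonneg (mul_nonneg (mul_nonneg (mul_nonneg (mul_nonneg (mul_nonneg (mul_nonneg hE1 hE1) hE1) hE2) hE2) hE3) hE3) hK.le) hK.le,
      mul_nonneg (mul_nonneg (mul_nonneg (mul_nonneg (mul_nonneg (mul_nonneg (mul_nonneg (mul_nonneg hE1 hE1) hE1) hE2) hE2) hE3) hE3) hClo) hK.le,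
      mul_nonneg (mul_nonneg (mul_nonneg (mul_nonneg (mul_nonneg (mul_nonneg hA1 hE1) hE2) hE2) hE3) hE3) hClo,
      mul_nonneg (mul_nonneg (mul_nonneg (mul_nonneg (mul_nonneg (mul_nonneg hA1 hE1) hE1) hE2) hE3) hE3) hK.le,
      mul_nonneg (mul_nonneg (mul_nonneg (mul_nonneg (mul_nonneg (mul_nonneg hA1 hE1) hE1) hE2) hE3) hE3) hClo,
      mul_nonneg (mul_nonneg (mul_nonneg (mul_nonneg (mul_nonneg (mul_nonneg hA1 hE1) hE1) hE2) hE2) hE3) hK.le,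
      mul_nonneg (mul_nonneg (mul_nonneg (mul_nonneg (mul_nonneg (mul_nonneg hA1 hE1) hE1) hE2) hE2) hE3) hClo,
      mul_nonneg (mul_nonneg (mul_nonneg (mul_nonneg (mul_nonneg (mul_nonneg hA1 hE1) hE1) hE1) hE2) hE3) hK.le,
      mul_nonneg (mul_nonneg (mul_nonneg (mul_nonneg (mul_nonneg (mul_nonneg hA1 hA1) hE1) hE2) hE2) hE3) hE3]
  -- from the largest floor to `x`: the inequality is linear in `x`
  have hQ : 0 ≤ u0 * ((2 * K - 3 * lo) * u0 + (K - 3 * lo) * u1) + 3 * lo * (u0 + u1) ^ 2 := by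
    have := mul_nonneg hu0n hbr; positivity
  have h1 : x * (lo + K) * (u0 * ((2 * K - 3 * lo) * u0 + (K - 3 * lo) * u1) + 3 * lo * (u0 + u1) ^ 2)
      ≤ (lo + K * g₁) * (u0 * ((2 * K - 3 * lo) * u0 + (K - 3 * lo) * u1) + 3 * lo * (u0 + u1) ^ 2) := mul_le_mul_of_nonneg_right hxg hQ
  have h2 : (lo + K) * (x * (u0 * ((2 * K - 3 * lo) * u0 + (K - 3 * lo) * u1)) - 3 * lo * (1 - x) * (u0 + u1) ^ 2) ≤ 0 := by
    have e1 : (lo + K) * (x * (u0 * ((2 * K - 3 * lo) * u0 + (K - 3 * lo) * u1)) - 3 * lo * (1 - x) * (u0 + u1) ^ 2)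
        = x * (lo + K) * (u0 * ((2 * K - 3 * lo) * u0 + (K - 3 * lo) * u1) + 3 * lo * (u0 + u1) ^ 2) - 3 * lo * (lo + K) * (u0 + u1) ^ 2 := by
      ring
    have e2 : (lo + K * g₁) * (u0 * ((2 * K - 3 * lo) * u0 + (K - 3 * lo) * u1) + 3 * lo * (u0 + u1) ^ 2) - 3 * lo * (lo + K) * (u0 + u1) ^ 2
        = (lo + K * g₁) * (u0 * ((2 * K - 3 * lo) * u0 + (K - 3 * lo) * u1)) - 3 * lo * K * (1 - g₁) * (u0 + u1) ^ 2 := by ring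
    rw [e1]; linarith
  have h3 : x * (u0 * ((2 * K - 3 * lo) * u0 + (K - 3 * lo) * u1)) - 3 * lo * (1 - x) * (u0 + u1) ^ 2 ≤ 0 := by
    by_contra hc; push Not at hc
    have := mul_pos hB0 hc; linarith
  have e2 : x * u0 * ((2 * K - 3 * lo) * u0 + (K - 3 * lo) * u1) = x * (u0 * ((2 * K - 3 * lo) * u0 + (K - 3 * lo) * u1)) := by ring
  rw [e2]; linarith

end LawDec
end Quant
end Summit.CriticalPhenomena.PercolationContinuityZ3.Theorems
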